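import Mathlib.Tactic.Module
import Mathlib.Tactic.LinearCombination
import Mathlib.SetTheory.Cardinal.Finite
import Mathlib.Algebra.Module.LinearMap.Defs
import Literature.NumberTheory.GaloisRepresentations.LubinTate
import HarnessLib

/-!
# Semilinear descent along an unramified quadratic base for a `ℤ[ω]`-structure with `3` invertible:
# `M = M^φ ⊕ ω·M^φ`, `H¹(⟨φ⟩, M) = 0`, `Ĥ⁰(⟨φ⟩, M) = 0` — the algebra of (UQ2) «`E⁺(ℚ₄·k_n) = ℤ₄ ⊗ E⁺(k_n)`» and of
# «`dim_{𝔽₂} R⁺(ℚ_∞) = dim_{𝔽₄} R⁺(K_∞)`» for (R≥)ᵖ, kernel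

Route `ResidualThetaTransportAtTwo` (RTT), crux (R≥)ᵖ `ResidualThetaCountLowerPureAtTwo` (stmt-BirchSwinnertonDyer-26074); seat
`prover-bsd-wall-rtt-p2` g9 (`--supports`, closes nothing); memo `Cruxes/ResidualThetaCountLowerPureAtTwo/RELATIVE-LT-g9.md` §2(a),(c).
HONEST FRAMING: THEOREMS ONLY (no definition, no named fact, no instance, no `sorry`); pure module algebra, route-independent;
nothing about any Selmer group or formal group is asserted here; BSD is not proved by any of this.

WHY. By `…RelativeLubinTateSeries/Module` (p608987 / sequel) the formal group `Ŵ ⊗ ℤ₄` of a habitat curve is a formal `ℤ₄`-module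
(`[ω]`, `ω² + ω + 1 = 0`) on which the Frobenius `φ` of `ℤ₄/ℤ₂` acts SEMILINEARLY (`[ω]^φ = [ω²]`). Hence every group of points it
defines over an unramified quadratic extension `k' = ℚ₄·k` — `Ê(𝔪_{k'})`, Kobayashi's `E^±(k')`, their Kummer images — is a
`ℤ₂`-module `M` with commuting data: a `ℤ₂`-linear `ω` with `ω² + ω + 1 = 0`, the `ℤ₂`-linear involution `φ = Gal(k'/k)`, and
`φω = ω²φ`. This file proves that such an `M` is AUTOMATICALLY induced: **`M = M^φ ⊕ ω M^φ`** (explicitly `x = u + ωv`,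
`u = ⅓(a − b)`, `v = ⅓(−a − 2b)`, `a = x + φx`, `b = ωx + φ(ωx)`; only `3 ∈ R^×` is used — true in `ℤ₂`, `ℤ/2ⁿ`, `𝔽₂`), and
consequently **`H¹(⟨φ⟩, M) = 0`** (`x + φx = 0 ⇒ x = φy − y` with `y = ⅓·ω(ωx + φ(ωx))`) and **`Ĥ⁰(⟨φ⟩, M) = 0`** (`φu = u ⇒ u = x + φx`
with `x = −ωu`). For (UQ2) of `RMC-ROADS-g6.md` §1 this REPLACES the «HONDA⁺@2 over ℤ₄» generation argument: `E⁺(k')^φ = E⁺(k)`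
is formal, and the trace `E⁺(k') → E⁺(k)` is onto and `H¹ = 0` by this file — no Nakayama count over `𝔽₄`. With `R = 𝔽₂` it is the
descent `#M = (#M^c)²` for the residual Selmer groups over `K_∞ ⊃ ℚ_∞` (ROAD C, `c` = complex conjugation, `ω = ρ̄(3-cycle)`).

WHAT (`R` a commutative ring with `3t = 1`; `M` an `R`-module; `ω, φ : M →ₗ[R] M` with `ω(ωx) + ωx + x = 0`, `φ(φx) = x`,
`φ(ωx) = ω(ω(φx))`): `fixed_of_add_conj`, `decomposition` (`x = u + ωv` with the explicit fixed `u, v`), `fixed_coords_unique`,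
**`fixed_add_omega_fixed_bijective`** (`M^φ × M^φ → M`, `(u,v) ↦ u + ωv` bijective), **`natCard_eq_natCard_fixed_sq`** (`#M = (#M^φ)²`),
**`exists_conj_sub_of_add_conj_eq_zero`** (`H¹ = 0`), **`exists_add_conj_of_fixed`** (`Ĥ⁰ = 0`: every fixed vector is a trace).

References: [SerreLocalFields1979] Ch. X §1 (Galois descent, Hilbert 90); [CasselsFrohlichANT1967] Ch. IV §6 (induced modules are
cohomologically trivial); Auslander–Goldman (the crossed product of an unramified extension is a matrix algebra) for context.
-/

set_option autoImplicit false
-- the Theorems namespace of this sub repeats the summit name by design (D-0017 nested layout)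
set_option linter.dupNamespace false

namespace Summit.BirchSwinnertonDyer.BirchSwinnertonDyer.Theorems.SemilinearDescent

variable {R : Type*} [CommRing R] {M : Type*} [AddCommGroup M] [Module R M] (ω φ : M →ₗ[R] M) {t : R}
  (ht : 3 * t = 1) (hω : ∀ x : M, ω (ω x) + ω x + x = 0) (hφ : ∀ x : M, φ (φ x) = x)
  (hφω : ∀ x : M, φ (ω x) = ω (ω (φ x)))

include hω in
/-- `ω² = −ω − 1`. [folklore] -/
theorem omega_omega (x : M) : ω (ω x) = -(ω x) - x := by
  have h := hω x
  rw [← sub_eq_zero]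
  rw [← h]
  abel

include hφ in
/-- `x + φx` is `φ`-fixed. [folklore] -/
theorem fixed_add_conj (x : M) : φ (x + φ x) = x + φ x := by
  rw [map_add, hφ, add_comm]

include ht hω hφω in
/-- **The decomposition `x = u + ωv`** with `u = t(a − b)`, `v = t(−a − 2b)`, `a = x + φx`, `b = ωx + φ(ωx)` (`3t = 1`): every
vector lies in `M^φ + ωM^φ`. [cite: SerreLocalFields1979, Ch. X §1] -/
theorem decomposition (x : M) :
    x = t • ((x + φ x) - (ω x + φ (ω x))) + ω (t • (-(x + φ x) - (2 : R) • (ω x + φ (ω x)))) := by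
  have h1 : φ (ω x) = -(ω (φ x)) - φ x := by rw [hφω, omega_omega ω hω]
  have h2 : ω (ω (φ x)) = -(ω (φ x)) - φ x := omega_omega ω hω (φ x)
  have h3 : ω (ω x) = -(ω x) - x := omega_omega ω hω x
  rw [h1]
  simp only [map_smul, map_sub, map_add, map_neg, h3, h2]
  -- an identity in the atoms `x, φ x, ω x, ω (φ x)` with scalar `t`, `3t = 1`
  have hx : x = (3 * t) • x := by rw [ht, one_smul]
  conv_lhs => rw [hx]
  module

include hφ in
/-- The two coordinates of the decomposition are `φ`-fixed. [folklore] -/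
theorem fixed_coords (x : M) :
    φ (t • ((x + φ x) - (ω x + φ (ω x)))) = t • ((x + φ x) - (ω x + φ (ω x))) ∧
      φ (t • (-(x + φ x) - (2 : R) • (ω x + φ (ω x)))) = t • (-(x + φ x) - (2 : R) • (ω x + φ (ω x))) := by
  have ha : φ (x + φ x) = x + φ x := fixed_add_conj φ hφ x
  have hb : φ (ω x + φ (ω x)) = ω x + φ (ω x) := fixed_add_conj φ hφ (ω x)
  constructor
  · rw [map_smul, map_sub, ha, hb]
  · rw [map_smul, map_sub, map_neg, map_smul, ha, hb]

include hω hφω in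
/-- **Uniqueness of the coordinates**: if `x = u + ωv` with `φu = u`, `φv = v` then `x + φx = 2u − v` and `ωx + φ(ωx) = −u − v`; hence
`3u = a − b`, `3v = −a − 2b`. [cite: SerreLocalFields1979, Ch. X §1] -/
theorem coords_of_eq {x u v : M} (hu : φ u = u) (hv : φ v = v) (hx : x = u + ω v) :
    x + φ x = (2 : R) • u - v ∧ ω x + φ (ω x) = -u - v := by
  have h3u : ω (ω u) = -(ω u) - u := omega_omega ω hω u
  have h3v : ω (ω v) = -(ω v) - v := omega_omega ω hω v
  subst hx
  constructor
  · simp only [map_add, hφω, hu, hv, h3v]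
    module
  · simp only [map_add, map_sub, map_neg, hφω, hu, hv, h3u, h3v]
    module

include ht hω hφ hφω in
/-- **`M^φ × M^φ → M`, `(u, v) ↦ u + ωv` is a bijection** — `M = M^φ ⊕ ωM^φ ≅ R[ω] ⊗_R M^φ`: a module with a semilinear involution over
the quadratic `ω`-extension is INDUCED from its fixed vectors (`3 ∈ R^×`). [cite: SerreLocalFields1979, Ch. X §1] -/
theorem fixed_add_omega_fixed_bijective :
    Function.Bijective (fun uv : {x : M // φ x = x} × {x : M // φ x = x} ↦ (uv.1 : M) + ω (uv.2 : M)) := by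
  refine ⟨?_, fun x ↦ ?_⟩
  · rintro ⟨⟨u, hu⟩, ⟨v, hv⟩⟩ ⟨⟨u', hu'⟩, ⟨v', hv'⟩⟩ h
    change u + ω v = u' + ω v' at h
    obtain ⟨ha, hb⟩ := coords_of_eq ω φ hω hφω hu hv rfl
    obtain ⟨ha', hb'⟩ := coords_of_eq ω φ hω hφω hu' hv' h
    -- `2u − v = 2u' − v'` and `−u − v = −u' − v'` give `3u = 3u'`, `3v = 3v'`
    have e1 : (2 : R) • u - v = (2 : R) • u' - v' := ha.symm.trans ha'
    have e2 : -u - v = -u' - v' := hb.symm.trans hb'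
    have hu3 : u = u' := by
      have : (3 * t) • u = (3 * t) • u' := by linear_combination (norm := module) t • e1 - t • e2
      rwa [ht, one_smul, one_smul] at this
    have hv3 : v = v' := by
      have : (3 * t) • v = (3 * t) • v' := by linear_combination (norm := module) (-t) • e1 - ((2 : R) * t) • e2
      rwa [ht, one_smul, one_smul] at this
    subst hu3; subst hv3; rfl
  · obtain ⟨hfa, hfb⟩ := fixed_coords ω φ hφ x (t := t)
    exact ⟨(⟨_, hfa⟩, ⟨_, hfb⟩), (decomposition ω φ ht hω hφω x).symm⟩

include ht hω hφ hφω in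
/-- **`#M = (#M^φ)²`** (with `R = 𝔽₂`, `φ = c`, `ω = ρ̄(3-cycle)`: `dim_{𝔽₂} R⁺_{S₀}(W[2]/ℚ_∞) = dim_{𝔽₄} R⁺_S(W[2]/K_∞)` once the local
conditions are `ω`- and `c`-stable). [cite: SerreLocalFields1979, Ch. X §1] -/
theorem natCard_eq_natCard_fixed_sq : Nat.card M = Nat.card {x : M // φ x = x} ^ 2 := by
  rw [← Nat.card_congr (Equiv.ofBijective _ (fixed_add_omega_fixed_bijective ω φ ht hω hφ hφω)), Nat.card_prod, sq]

include ht hω hφω in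
/-- **`H¹(⟨φ⟩, M) = 0`**: every `x` with `x + φx = 0` is `φy − y`, namely `y = t·ω(ωx + φ(ωx))`. For (UQ2): `H¹(Gal(ℚ₄k/k), E⁺(ℚ₄k)) = 0`.
[cite: CasselsFrohlichANT1967, Ch. IV §6] -/
theorem exists_conj_sub_of_add_conj_eq_zero {x : M} (hx : x + φ x = 0) : ∃ y : M, x = φ y - y := by
  refine ⟨t • ω (ω x + φ (ω x)), ?_⟩
  have hφx : φ x = -x := eq_neg_of_add_eq_zero_right hx
  have h1 : φ (ω x) = -(ω (φ x)) - φ x := by rw [hφω, omega_omega ω hω]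
  have h3 : ω (ω x) = -(ω x) - x := omega_omega ω hω x
  -- `φ(ωx) = ωx + x`, so `y = t • ω(2ωx + x) = t • (−ωx − 2x)` and `φy − y = 3t • x`
  have hφωx : φ (ω x) = ω x + x := by rw [h1, hφx, map_neg]; abel
  simp only [map_smul, map_add, map_sub, map_neg, hφωx, h3, hφx]
  have hx3 : x = (3 * t) • x := by rw [ht, one_smul]
  conv_lhs => rw [hx3]
  module

include hω hφω in
/-- **`Ĥ⁰(⟨φ⟩, M) = 0`: every `φ`-fixed vector is a trace**, `u = x + φx` with `x = −ωu` (no condition on `3`). For (UQ2): the trace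
`E⁺(ℚ₄k) → E⁺(k)` is onto. [cite: CasselsFrohlichANT1967, Ch. IV §6] -/
theorem exists_add_conj_of_fixed {u : M} (hu : φ u = u) : ∃ x : M, u = x + φ x := by
  refine ⟨-(ω u), ?_⟩
  rw [map_neg, hφω, hu, omega_omega ω hω u]
  abel

end Summit.BirchSwinnertonDyer.BirchSwinnertonDyer.Theorems.SemilinearDescent
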